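import Summits.HodgeConjecture.CorCM.HCCMOfRankFourWeilClasses
import Summits.HodgeConjecture.CorCM.WeilLineMonomials
import Summits.HodgeConjecture.CorCM.CM.Lemmas
import HarnessLib

/-!
# COR-CM (cell `pub-hodgecm2`): on a product of CM-typed realisations the Weil space `W_F ⊗ ℂ` of `F = ℚ(a₀)` IS the
# `F`-Weil-line space; the corner products of rank-four faces are of Weil type `(2,2)`; the rank-four input `B⁴` of the
# crux line `FaceReduction/birth` implies `HC_CM`

HONEST FRAMING (cell pub-hodgecm2 / COR-CM, seat b24 gen 21, count-neutral lane RANK4-HCCM, part 2; theorems only, no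
definition, no named fact; no case of the Hodge conjecture is proved).  Standard linear algebra of the Betti cohomology of
products of complex abelian varieties with complex multiplication, on the tree's real carriers, plus one junction.

Setting: a number field `K`, slots `j : Fin d`, complex abelian varieties `A j` with `𝓞_K`-actions `act j` realising CM
types `Ψ j` (`ComplexMultiplication.IsCMTypeRealisation`), an algebraic integer `a₀ ∈ 𝓞_K` SEPARATING the complex
embeddings (`σ ↦ σ(a₀)` injective, `AndreProductForm.exists_integer_separating`), and the diagonal endomorphism
`ψ = act(a₀)` of `⨁_j A_j` (`AndreProductForm.diagHom`).

* `eq_of_forall_prod_natCast_add_eq_pow` — character separation along the naturals: if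
  `∏_{i ∈ S} (n + z_i) = (n + ρ)^{#S}` for every `n ∈ ℕ` then every `z_i` equals `ρ` (the two monic polynomials agree at
  infinitely many points; compare roots) — the variant of `WeilLineMonomial.eq_of_forall_prod_eq_pow` that only needs
  the translates `n + a₀` of ONE element;
* **`pullbackEigenclasses_diagHom_le_weilLineClasses`** — for every complex number `ρ`, the simultaneous eigenclass
  space `{c ∈ H^d | (x·𝟙 + y·ψ)^* c = (x + yρ)^d c ∀ x y ∈ ℕ}` (the tree's `HodgeTheory.pullbackEigenclasses`, the
  carrier of the route item `RankFourFaces.RankFourWeilClasses` and of the crux line `Cruxes/FaceReduction/Lines/birth.lean`)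
  lies in the `K`-Weil-line space `weilLineClasses A act d` (`= ⊕_s ℂ·μ_s`, `WeilLineMonomial.weilLineClasses_eq_iSup_span_monomial`):
  in the wedge basis on the eigen-line basis of `H¹(⨁ A)` the endomorphism `x·𝟙 + y·ψ = act(x + y a₀)` is diagonal with
  eigenvalue `∏_{(j,σ) ∈ S} (x + y σ(a₀))` on the wedge monomial of the label set `S`
  (`WeilLineMonomial.map_wedgeBasis_of_diag`), so a non-zero coordinate of an eigenclass forces
  `∏_{(j,σ)∈S} (n + σ(a₀)) = (n + ρ)^d` for all `n`, hence all labels of `S` carry ONE embedding `s` (with `s(a₀) = ρ`), i.e.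
  `S = Fin d × {s}` and the wedge monomial is `μ_s`; hence **`weilClassesField (⨁ A) ψ P d ≤ weilLineClasses A act d`**
  for every `P` (`weilClassesField_diagHom_le_weilLineClasses`) and, with lit-milne's converse
  `Milne2020.weilLineClasses_le_weilClassesField`, **equality for `P = minpoly_ℤ(a₀)`**
  (`weilClassesField_diagHom_minpoly_eq_weilLineClasses`: Moonen–Zarhin's `W_F ⊗ ℂ = ⊕_σ ⋀^d V_{ℂ,σ}` on the product);
* `isOfHodgeType_of_mem_weilLineClasses` — if every embedding `s` lies in exactly `p` of the types `Ψ j` and outside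
  exactly `q` of them, every (complex) class of `weilLineClasses A act d` is of Hodge type `(p,q)` (each monomial `μ_s` is,
  `WeilLineMonomial.isOfHodgeType_monomial`; classes of type `(p,q)` form a subspace, `IsOfHodgeType.add/smul` over the
  tree theorem `hodgePQ_independent_of_hodgeModel_holds`); for the four corners of a rank-four FACE (`Σ_i 1_{Φ_i} = 2`,
  rfwf Lemma 1.2 = `sumTwo_corner`) this is type `(2,2)`: `card_filter_mem_corner_eq_two`,
  **`isOfHodgeType_two_two_of_mem_weilClassesField_corner`** — the corner product `(⨁_j A_{(F, f.corner j)}, act(a₀))`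
  is an E-CM 4-product OF WEIL TYPE in the sense of the crux line;
* **`hc_cm_of_rankFourCMProductWeilClassesAlgebraic`** — the statement `B⁴ = RankFourCMProductWeilClassesAlgebraic` of
  `Cruxes/FaceReduction/Lines/birth.lean` (rational `(2,2)` E-Weil classes on E-CM 4-products of Weil type are algebraic,
  `g ≥ 2`), restated VERBATIM as a hypothesis, implies `HC_CM` (part 1, `RankFourWeil.hc_cm_of_forall_face_weilClassesField`,
  at the corner products: `B i = A_{(F, f.corner i)}` of dimension `g = [F:ℚ]/2`, `ψ i = act_i(a₀)`, `Y = ⨁ B` with its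
  biproduct projections — a limit fan —, `φ = act(a₀)`, `P = minpoly_ℤ(a₀)`).

References: [MoonenZarhin1998WeilClasses] B. Moonen, Yu. Zarhin, J. reine angew. Math. 496 (1998) §1;
[Deligne1982HodgeCycles] LNM 900 §4 (4.4); [Milne2020HodgeClassesAV] §2 2.1–2.2; [CharlesSchnell2014Notes] Lemma 11.5.18,
Prop. 11.5.20; [LangeBirkenhake1992] Lemma 1.1.17; rfwf v3 Lemma 1.2 (`CorCM/CM/Lemmas.lean`).
-/

noncomputable section

open CategoryTheory CategoryTheory.Limits NumberField Polynomial
open Literature.AlgebraicTopology.SingularHomology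
open Literature.AlgebraicGeometry Literature.AlgebraicGeometry.Motives Literature.AlgebraicGeometry.HodgeTheory
open Literature.AlgebraicGeometry.ComplexMultiplication Literature.AlgebraicGeometry.Milne1999
open Literature.NumberTheory.Automorphic
open Literature.NumberTheory.Automorphic.PicardCM (eigenline BallQuotientUniformisedDatum CMAbelianVarietyRealised)
open Summit.HodgeConjecture.CorCM.Model
open Summit.HodgeConjecture.CorCM.AndreProductForm
open Summit.HodgeConjecture.CorCM.Milne2020
open Summit.HodgeConjecture.CorCM.WeilLineMonomial

namespace Summit.HodgeConjecture.CorCM.RankFourWeil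

/-! ## §1 Character separation along the naturals -/

/-- **Character separation along the naturals.** If `∏_{i ∈ S} (n + z_i) = (n + ρ)^{#S}` for every natural number
`n`, then `z_i = ρ` for every `i ∈ S`: the monic polynomials `∏ (X + z_i)` and `(X + ρ)^{#S}` agree at infinitely many
points, hence are equal, hence have the same roots. [folklore] -/
theorem eq_of_forall_prod_natCast_add_eq_pow {ι : Type*} (S : Finset ι) (z : ι → ℂ) (ρ : ℂ)
    (h : ∀ n : ℕ, ∏ i ∈ S, ((n : ℂ) + z i) = ((n : ℂ) + ρ) ^ S.card) : ∀ i ∈ S, z i = ρ := by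
  classical
  set P : ℂ[X] := ∏ i ∈ S, (X + C (z i)) with hP
  set Q : ℂ[X] := (X + C ρ) ^ S.card with hQ
  have hPQ : P = Q := by
    apply Polynomial.eq_of_infinite_eval_eq
    refine Set.Infinite.mono ?_ (Set.infinite_range_of_injective (Nat.cast_injective (R := ℂ)))
    rintro _ ⟨n, rfl⟩
    simp only [Set.mem_setOf_eq, hP, hQ, eval_prod, eval_add, eval_X, eval_C, eval_pow]
    exact h n
  have hQroots : Q.roots = Multiset.replicate S.card (-ρ) := by
    rw [hQ, roots_pow, roots_X_add_C, Multiset.nsmul_singleton]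
  have hPne : P ≠ 0 := by
    rw [hPQ, hQ]
    exact pow_ne_zero _ (X_add_C_ne_zero _)
  have hProots : P.roots = S.val.map fun i => -(z i) := by
    rw [hP, roots_prod _ _ (hP ▸ hPne)]
    simp only [roots_X_add_C, Multiset.bind_singleton]
  intro i hi
  have hmem : -(z i) ∈ P.roots := by
    rw [hProots]
    exact Multiset.mem_map_of_mem _ hi
  rw [hPQ, hQroots] at hmem
  exact neg_injective (Multiset.eq_of_mem_replicate hmem)

/-! ## §2 `W_F ⊗ ℂ` of `F = ℚ(a₀)` on a product of realisations is the `K`-Weil-line space -/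

section Product

variable {K : Type} [Field K] [NumberField K]
variable {d : ℕ} {A : Fin d → AbelianVariety ℂ} {act : ∀ j, 𝓞 K →+* End (A j)}
  {θ : ∀ j, K →+* Module.End ℂ (complexBetti (A j).X 1)} {Ψ : Fin d → CMType K}

/-- **The eigenclasses of `x·𝟙 + y·act(a₀)` with character `(x + yρ)^d` are `K`-Weil-line classes**, for a separating
integer `a₀` and ANY complex number `ρ` (if `ρ` is not a conjugate of `a₀` the space is zero).  In the wedge basis on the
eigen-line basis of `H¹(⨁ A)`, `act(n + a₀)` has eigenvalue `∏_{(j,σ) ∈ S} (n + σ(a₀))` on the wedge monomial of `S`; a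
non-zero coordinate of an eigenclass gives `∏_{(j,σ)∈S} (n + σ(a₀)) = (n + ρ)^d` for all `n`, so every label of `S`
carries one embedding `s` (`eq_of_forall_prod_natCast_add_eq_pow`, `a₀` separating), `S = Fin d × {s}`, and the wedge
monomial is `μ_s ∈ weilLineClasses` (`WeilLineMonomial.wedgeBasis_slotSet`, `monomial_mem_weilLineClasses`).
[cite: MoonenZarhin1998WeilClasses, §1 (W_F ⊗ ℂ = ⊕_σ ⋀^r V_{ℂ,σ})] [cite: Deligne1982HodgeCycles, §4 (4.4)] -/
theorem pullbackEigenclasses_diagHom_le_weilLineClasses (hA : ∀ j, IsCMTypeRealisation (Ψ j) (A j) (act j) (θ j))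
    (hd : 0 < d) (a₀ : 𝓞 K) (hsep : Function.Injective fun σ : K →+* ℂ => σ (a₀ : K)) (ρ : ℂ) :
    pullbackEigenclasses (⨁ A) (diagHom K A act a₀) d (fun x y => ((x : ℂ) + (y : ℂ) * ρ) ^ d) ≤
      weilLineClasses A act d := by
  classical
  letI := labelOrder K d
  -- eigen-line bases of the factors and the wedge basis of `H^d(⨁ A)`
  let v : ∀ j, Module.Basis (K →+* ℂ) ℂ (complexBetti (A j).X 1) := fun j => (exists_eigenbasis (hA j)).choose
  have hv : ∀ j σ, v j σ ∈ eigenline (θ j) σ := fun j => (exists_eigenbasis (hA j)).choose_spec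
  let Bw := wedgeBasis (⨁ A) (biprodBasis A v) d
  have hact : ∀ (a : 𝓞 K) (S : Set.powersetCard (Fin d × (K →+* ℂ)) d),
      complexBetti.map (diagHom K A act a).hom.hom.hom d (Bw S) =
        (∏ i ∈ (S : Finset (Fin d × (K →+* ℂ))), i.2 (a : K)) • Bw S :=
    fun a S => map_wedgeBasis_of_diag (⨁ A) (biprodBasis A v) d (diagHom K A act a)
      (fun i => i.2 (a : K)) (fun i => map_diagHom_biprodBasis K A act hA hv a i.1 i.2) S
  intro c hc
  rw [mem_pullbackEigenclasses_iff] at hc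
  -- the eigen-relation for `act(n + a₀)`
  have heig : ∀ n : ℕ, complexBetti.map (diagHom K A act ((n : 𝓞 K) + a₀)).hom.hom.hom d c =
      (((n : ℂ) + ρ) ^ d) • c := by
    intro n
    have h1 := hc n 1
    rw [nsmul_id_add_nsmul_diagHom, Nat.cast_one, one_mul, Nat.cast_one, one_mul] at h1
    exact h1
  -- coordinates off the constant label sets vanish
  have hcoord : ∀ S, Bw.repr c S ≠ 0 →
      ∃ s : K →+* ℂ, S = slotSet d s := by
    intro S hS
    have hchar : ∀ n : ℕ, ∏ i ∈ (S : Finset (Fin d × (K →+* ℂ))), ((n : ℂ) + i.2 (a₀ : K)) =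
        ((n : ℂ) + ρ) ^ (S : Finset (Fin d × (K →+* ℂ))).card := by
      intro n
      have h2 := repr_apply_of_diag Bw (complexBetti.map (diagHom K A act ((n : 𝓞 K) + a₀)).hom.hom.hom d).hom
        (fun T => ∏ i ∈ (T : Finset (Fin d × (K →+* ℂ))), i.2 (((n : 𝓞 K) + a₀ : 𝓞 K) : K)) (fun T => hact _ T) c S
      have h3 : (complexBetti.map (diagHom K A act ((n : 𝓞 K) + a₀)).hom.hom.hom d).hom c = (((n : ℂ) + ρ) ^ d) • c :=
        heig n
      rw [h3, map_smul, Finsupp.smul_apply, smul_eq_mul] at h2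
      have h4 := (mul_right_cancel₀ hS h2).symm
      rw [Set.powersetCard.card_eq]
      refine Eq.trans (Finset.prod_congr rfl fun i _ => ?_) h4
      simp [map_add, map_natCast]
    have hne : (S : Finset (Fin d × (K →+* ℂ))).Nonempty := by
      rw [← Finset.card_pos, Set.powersetCard.card_eq]
      exact hd
    obtain ⟨i₀, hi₀⟩ := hne
    have hlab := eq_of_forall_prod_natCast_add_eq_pow (S : Finset (Fin d × (K →+* ℂ))) (fun i => i.2 (a₀ : K)) ρ hchar
    refine ⟨i₀.2, ?_⟩
    rw [Set.powersetCard.eq_iff_subset]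
    intro i hi
    rw [mem_slotSet_iff]
    exact hsep ((hlab i hi).trans (hlab i₀ hi₀).symm)
  -- hence `c` is a combination of monomials
  rw [← Bw.sum_repr c]
  refine Submodule.sum_mem _ fun S _ => ?_
  by_cases hS : Bw.repr c S = 0
  · rw [hS, zero_smul]
    exact Submodule.zero_mem _
  · obtain ⟨s, rfl⟩ := hcoord S hS
    refine Submodule.smul_mem _ _ ?_
    change wedgeBasis (⨁ A) (biprodBasis A v) d (slotSet d s) ∈ weilLineClasses A act d
    rw [wedgeBasis_slotSet s (strictMono_slot s)]
    exact monomial_mem_weilLineClasses hA hv s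

/-- **`W_F ⊗ ℂ ≤` the `K`-Weil-line space**: for every `P ∈ ℤ[T]`, the complexified Weil space
`weilClassesField (⨁ A) (act a₀) P d = ⨆_{P(ρ)=0} {eigenclasses of character (x + yρ)^d}` lies in `weilLineClasses A act d`.
[cite: MoonenZarhin1998WeilClasses, §1] -/
theorem weilClassesField_diagHom_le_weilLineClasses (hA : ∀ j, IsCMTypeRealisation (Ψ j) (A j) (act j) (θ j))
    (hd : 0 < d) (a₀ : 𝓞 K) (hsep : Function.Injective fun σ : K →+* ℂ => σ (a₀ : K)) (P : Polynomial ℤ) :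
    weilClassesField (⨁ A) (diagHom K A act a₀) P d ≤ weilLineClasses A act d := by
  unfold weilClassesField
  exact iSup₂_le fun ρ _ => pullbackEigenclasses_diagHom_le_weilLineClasses hA hd a₀ hsep ρ

/-- **`W_F ⊗ ℂ` IS the `K`-Weil-line space** for `F = ℚ(a₀)`, `P = minpoly_ℤ(a₀)`: Moonen–Zarhin's
`W_F ⊗ ℂ = ⊕_σ ⋀^d V_{ℂ,σ}` on a product of realisations (`≥`: lit-milne's `Milne2020.weilLineClasses_le_weilClassesField`).
[cite: MoonenZarhin1998WeilClasses, §1 (W_F ⊗ ℂ = ⊕_σ ⋀^r V_{ℂ,σ})] [cite: Milne2020HodgeClassesAV, §2 2.1–2.2] -/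
theorem weilClassesField_diagHom_minpoly_eq_weilLineClasses (hA : ∀ j, IsCMTypeRealisation (Ψ j) (A j) (act j) (θ j))
    (hd : 0 < d) (a₀ : 𝓞 K) (hsep : Function.Injective fun σ : K →+* ℂ => σ (a₀ : K)) :
    weilClassesField (⨁ A) (diagHom K A act a₀) (minpoly ℤ a₀) d = weilLineClasses A act d :=
  le_antisymm (weilClassesField_diagHom_le_weilLineClasses hA hd a₀ hsep _)
    (weilLineClasses_le_weilClassesField K A act a₀ d)

/-! ## §3 Hodge types of `K`-Weil-line classes; the corner products of faces are of Weil type `(2,2)` -/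

open scoped Classical in
/-- **Constant Hodge type of the `K`-Weil-line space.** If every complex embedding `s` of `K` lies in exactly `p` of the
types `Ψ j` and outside exactly `q` of them, then every class of `weilLineClasses A act d` (`d ≥ 1`) is of Hodge type
`(p,q)` on `⨁ A`: the space is spanned by the monomials `μ_s` (`WeilLineMonomial.weilLineClasses_eq_span_range_monomial`),
each of type `(#{j : s ∈ Ψ_j}, #{j : s ∉ Ψ_j}) = (p,q)` (`isOfHodgeType_monomial`), and the classes of type `(p,q)` form a
`ℂ`-subspace (`IsOfHodgeType.zero/add/smul`, unconditional over `hodgePQ_independent_of_hodgeModel_holds`).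
[cite: CharlesSchnell2014Notes, Lemma 11.5.18 and Prop. 11.5.20] [cite: Milne2020HodgeClassesAV, §2 2.1–2.2] -/
theorem isOfHodgeType_of_mem_weilLineClasses (hA : ∀ j, IsCMTypeRealisation (Ψ j) (A j) (act j) (θ j))
    (hd : 0 < d) {p q : ℕ}
    (hcount : ∀ s : K →+* ℂ, (Finset.univ.filter fun j => s ∈ (Ψ j).1).card = p ∧
      (Finset.univ.filter fun j => s ∉ (Ψ j).1).card = q)
    {c : complexBetti (⨁ A).X d} (hc : c ∈ weilLineClasses A act d) :
    IsOfHodgeType (⨁ A).dim (⨁ A).X d p q c := by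
  let v : ∀ j, Module.Basis (K →+* ℂ) ℂ (complexBetti (A j).X 1) := fun j => (exists_eigenbasis (hA j)).choose
  have hv : ∀ j σ, v j σ ∈ eigenline (θ j) σ := fun j => (exists_eigenbasis (hA j)).choose_spec
  have hX : IsSmoothProjective (⨁ A).dim (⨁ A).X := AbelianVariety.isSmoothProjective_holds
  obtain ⟨M⟩ := nonempty_hodgeModel_holds hX
  rw [weilLineClasses_eq_span_range_monomial hA hv] at hc
  refine Submodule.span_induction (p := fun x _ => IsOfHodgeType (⨁ A).dim (⨁ A).X d p q x) ?_ ?_ ?_ ?_ hc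
  · rintro _ ⟨s, rfl⟩
    obtain ⟨h1, h2⟩ := hcount s
    have h := isOfHodgeType_monomial (A := A) (act := act) (v := v) hA hv hd s
    rwa [h1, h2] at h
  · exact IsOfHodgeType.zero M d p q
  · intro x y _ _ hx hy
    exact hx.add hX hy
  · intro t x _ hx
    exact hx.smul t

variable {L : Type} [Field L]

open scoped Classical in
/-- **rfwf Lemma 1.2 in counting form**: every complex embedding lies in exactly two of the four corners of a rank-four
face, and outside exactly two (`Σ_i 1_{Φ_i} = 2`, the tree's `sumTwo_corner`). [folklore] -/
theorem card_filter_mem_corner_eq_two (f : Face L) (s : L →+* ℂ) :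
    (Finset.univ.filter fun j : Fin 4 => s ∈ (f.corner j).1).card = 2 ∧
      (Finset.univ.filter fun j : Fin 4 => s ∉ (f.corner j).1).card = 2 := by
  have hsum := sumTwo_corner f s
  have hind : ∀ Φ : CMType L, ind Φ s = ((if s ∈ Φ.1 then 1 else 0 : ℕ) : ℤ) := by
    intro Φ
    unfold ind
    split_ifs <;> simp
  have h1 : (Finset.univ.filter fun j : Fin 4 => s ∈ (f.corner j).1).card = 2 := by
    rw [Finset.card_filter, Fin.sum_univ_four]
    rw [hind, hind, hind, hind] at hsum
    omega
  refine ⟨h1, ?_⟩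
  have h2 := Finset.card_filter_add_card_filter_not (s := (Finset.univ : Finset (Fin 4)))
    (fun j : Fin 4 => s ∈ (f.corner j).1)
  rw [h1, Finset.card_univ, Fintype.card_fin] at h2
  omega

end Product

/-! ### The corner products of the model universe -/

section Corners

/-- **The corner product of a rank-four face, with `act(a₀)`, is of WEIL TYPE `(2,2)`**: for every `P ∈ ℤ[T]` every class
of `weilClassesField (⨁_j A_{(F, f.corner j)}) (act a₀) P 4` is of Hodge type `(2,2)` (`a₀` separating).  This is the
hypothesis «of Weil type» of the statements `CMProductsReachRankFourFamily` / `RankFourCMProductWeilClassesAlgebraic` of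
`Cruxes/FaceReduction/Lines/birth.lean` at the corner products. [cite: CharlesSchnell2014Notes, Lemma 11.5.18 and Prop. 11.5.22]
[cite: MoonenZarhin1998WeilClasses, §1] -/
theorem isOfHodgeType_two_two_of_mem_weilClassesField_corner (h₃ : CMAbelianVarietyRealised) (F : CMField)
    (f : Face F) (a₀ : 𝓞 F)
    (hsep : Function.Injective fun σ : (F : Type) →+* ℂ => σ (a₀ : F)) (P : Polynomial ℤ)
    {c : complexBetti (⨁ cornerAV h₃ F f.corner).X 4}
    (hc : c ∈ weilClassesField (⨁ cornerAV h₃ F f.corner)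
      (diagHom F (cornerAV h₃ F f.corner) (cornerAct h₃ F f.corner) a₀) P 4) :
    IsOfHodgeType (⨁ cornerAV h₃ F f.corner).dim (⨁ cornerAV h₃ F f.corner).X 4 2 2 c := by
  classical
  exact isOfHodgeType_of_mem_weilLineClasses (cornerAV_isCMTypeRealisation h₃ F f.corner) (by norm_num)
    (card_filter_mem_corner_eq_two f)
    (weilClassesField_diagHom_le_weilLineClasses (cornerAV_isCMTypeRealisation h₃ F f.corner) (by norm_num) a₀ hsep P
      hc)

/-- `P(act_i(a₀)) = 0` in `End(A_{(F, Φ_i)})` for `P = minpoly_ℤ(a₀)` (each corner action is a ring homomorphism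
`𝓞_F → End`). [folklore] -/
theorem eval₂_cornerAct_minpoly (h₃ : CMAbelianVarietyRealised) (F : CMField) (Φ : Fin 4 → CMType F) (a₀ : 𝓞 F)
    (i : Fin 4) :
    Polynomial.eval₂ (Int.castRingHom (CategoryTheory.End (cornerAV h₃ F Φ i)))
      (cornerAct h₃ F Φ i a₀ : CategoryTheory.End (cornerAV h₃ F Φ i)) (minpoly ℤ a₀) = 0 := by
  have h0 : Polynomial.eval₂ (Int.castRingHom (𝓞 F)) a₀ (minpoly ℤ a₀) = 0 := by
    have := minpoly.aeval ℤ a₀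
    rwa [Polynomial.aeval_def, algebraMap_int_eq] at this
  have h1 := Polynomial.hom_eval₂ (minpoly ℤ a₀) (Int.castRingHom (𝓞 F)) (cornerAct h₃ F Φ i) a₀
  rw [h0, map_zero] at h1
  have h2 : (cornerAct h₃ F Φ i).comp (Int.castRingHom (𝓞 F)) =
      Int.castRingHom (CategoryTheory.End (cornerAV h₃ F Φ i)) := RingHom.ext_int _ _
  rw [h2] at h1
  exact h1.symm

/-- The biproduct projections intertwine `act(a₀)` on `⨁_j A_{(F, Φ_j)}` with `act_i(a₀)` on the factor. [folklore] -/
theorem biproduct_π_comp_cornerAct (h₃ : CMAbelianVarietyRealised) (F : CMField) (Φ : Fin 4 → CMType F) (a₀ : 𝓞 F)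
    (i : Fin 4) :
    biproduct.π (cornerAV h₃ F Φ) i ≫ cornerAct h₃ F Φ i a₀ =
      diagHom F (cornerAV h₃ F Φ) (cornerAct h₃ F Φ) a₀ ≫ biproduct.π (cornerAV h₃ F Φ) i :=
  (biproduct.map_π (fun j => cornerAct h₃ F Φ j a₀) i).symm

/-- The biproduct of the corners with its projections is a limit fan. [folklore] -/
theorem nonempty_isLimit_fan_cornerAV (h₃ : CMAbelianVarietyRealised) (F : CMField) (Φ : Fin 4 → CMType F) :
    Nonempty (IsLimit (Fan.mk (⨁ cornerAV h₃ F Φ) (biproduct.π (cornerAV h₃ F Φ)))) :=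
  ⟨biproduct.isLimit (cornerAV h₃ F Φ)⟩

/-- `dim A_{(F, Φ_i)} = [F:ℚ]/2`. [folklore] -/
theorem dim_cornerAV (h₃ : CMAbelianVarietyRealised) (F : CMField) (Φ : Fin 4 → CMType F) (i : Fin 4) :
    (cornerAV h₃ F Φ i).dim = Module.finrank ℚ F / 2 :=
  dim_eq_of_isCMTypeRealisation (cornerAV_isCMTypeRealisation h₃ F Φ i)

end Corners

/-! ## §4 The rank-four input `B⁴` of the crux line `FaceReduction/birth` implies `HC_CM` -/

/-- **`B⁴ ⟹ HC_CM`.**  The statement `RankFourCMProductWeilClassesAlgebraic` of `Cruxes/FaceReduction/Lines/birth.lean`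
(skeleton 907f1396fc06 of the crux `FaceReduction`, stmt-HodgeConjecture-16266) — «rational `(2,2)` E-Weil classes on E-CM
4-products of Weil type are algebraic, `g ≥ 2`», restated VERBATIM as the hypothesis — implies the Hodge conjecture for
every complex abelian variety of CM type.  It is applied only at the corner products of the rank-four faces of the Galois
CM fields `F` of degree `2g ≥ 6` (`RankFourWeil.hc_cm_of_forall_face_weilClassesField`): `B i = A_{(F, f.corner i)}`
(`dim = g`, `P(ψ_i) = 0` for `ψ_i = act_i(a₀)`, `P = minpoly_ℤ(a₀)` a CM polynomial of degree `2g`), `Y = ⨁ B` with its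
projections (a limit fan), `φ = act(a₀)`, of Weil type by `isOfHodgeType_two_two_of_mem_weilClassesField_corner`.
[cite: MoonenZarhin1998WeilClasses, §1] [cite: CharlesSchnell2014Notes, Prop. 11.5.22] [cite: Pohlmann1968, Thm. 1] -/
theorem hc_cm_of_rankFourCMProductWeilClassesAlgebraic
    (hB4 : ∀ (g : ℕ), 2 ≤ g → ∀ (P : Polynomial ℤ), P.Monic → P.natDegree = 2 * g →
      Irreducible (P.map (Int.castRingHom ℚ)) →
      (∀ ρ : ℂ, Polynomial.eval₂ (Int.castRingHom ℂ) ρ P = 0 → ρ.im ≠ 0) →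
      (∃ Q : Polynomial ℚ, ∀ ρ : ℂ, Polynomial.eval₂ (Int.castRingHom ℂ) ρ P = 0 →
        Polynomial.aeval ρ Q = (starRingEnd ℂ) ρ) →
      ∀ (B : Fin 4 → Literature.AlgebraicGeometry.Motives.AbelianVariety ℂ) (ψ : ∀ i, B i ⟶ B i),
        (∀ i, (B i).dim = g) →
        (∀ i, Polynomial.eval₂ (Int.castRingHom (CategoryTheory.End (B i)))
          (ψ i : CategoryTheory.End (B i)) P = 0) →
      ∀ (Y : Literature.AlgebraicGeometry.Motives.AbelianVariety ℂ) (φ : Y ⟶ Y) (π : ∀ i, Y ⟶ B i),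
        (∀ i, π i ≫ ψ i = φ ≫ π i) →
        Nonempty (CategoryTheory.Limits.IsLimit (CategoryTheory.Limits.Fan.mk Y π)) →
        Y.dim = 4 * g →
        Literature.AlgebraicGeometry.Motives.IsSmoothProjective (4 * g) Y.X →
        Polynomial.eval₂ (Int.castRingHom (CategoryTheory.End Y)) (φ : CategoryTheory.End Y) P = 0 →
        (∀ c ∈ (⨆ ρ ∈ {ρ : ℂ | Polynomial.eval₂ (Int.castRingHom ℂ) ρ P = 0},
            Literature.AlgebraicGeometry.HodgeTheory.pullbackEigenclasses Y φ 4
              (fun x y => ((x : ℂ) + (y : ℂ) * ρ) ^ 4)),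
          Literature.AlgebraicGeometry.HodgeTheory.IsOfHodgeType (4 * g) Y.X 4 2 2 c) →
      ∀ c : Literature.AlgebraicGeometry.HodgeTheory.complexBetti Y.X 4,
        Literature.AlgebraicGeometry.HodgeTheory.IsRationalClass c →
        Literature.AlgebraicGeometry.HodgeTheory.IsOfHodgeType (4 * g) Y.X 4 2 2 c →
        c ∈ (⨆ ρ ∈ {ρ : ℂ | Polynomial.eval₂ (Int.castRingHom ℂ) ρ P = 0},
            Literature.AlgebraicGeometry.HodgeTheory.pullbackEigenclasses Y φ 4
              (fun x y => ((x : ℂ) + (y : ℂ) * ρ) ^ 4)) →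
        c ∈ Literature.AlgebraicGeometry.HodgeTheory.algebraicClasses Y.X 2) :
    HC_CM := by
  refine hc_cm_of_forall_face_weilClassesField exists_isReal_hodgeModel_holds hodgePQ_independent_of_hodgeModel_holds
    BallQuotient.ballQuotientUniformisedDatum_holds cmAbelianVarietyRealised_holds ?_
  intro F hG h6 f a₀ hsep w hw hwQ hwH
  haveI : IsGalois ℚ (F : Type) := hG
  obtain ⟨hPm, hPirr, hPe, -, -⟩ := minpoly_facts (F : Type) a₀ hsep
  obtain ⟨-, -, -, -, hreal, hQ, -⟩ := isGaloisCMFieldPoly_minpoly (F : Type) a₀ hsep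
  -- `[F:ℚ] = 2g` with `g ≥ 3`
  have hfin : Module.finrank ℚ F = 2 * (Module.finrank ℚ F / 2) := by
    have h1 := IsTotallyComplex.finrank (K := (F : Type))
    omega
  set g : ℕ := Module.finrank ℚ F / 2 with hg_def
  have hg : 2 ≤ g := by omega
  have hdim : (⨁ cornerAV cmAbelianVarietyRealised_holds F f.corner).dim = 4 * g := by
    have hd := two_mul_dim_biproduct_cornerAV cmAbelianVarietyRealised_holds F f.corner
    omega
  have hsp : IsSmoothProjective (4 * g) (⨁ cornerAV cmAbelianVarietyRealised_holds F f.corner).X := by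
    rw [← hdim]
    exact AbelianVariety.isSmoothProjective_holds
  refine hB4 g hg (minpoly ℤ a₀) hPm (hPe.trans hfin) hPirr ?_ ?_
    (cornerAV cmAbelianVarietyRealised_holds F f.corner)
    (fun i => cornerAct cmAbelianVarietyRealised_holds F f.corner i a₀)
    (fun i => dim_cornerAV cmAbelianVarietyRealised_holds F f.corner i)
    (fun i => eval₂_cornerAct_minpoly cmAbelianVarietyRealised_holds F f.corner a₀ i)
    _ (diagHom F (cornerAV cmAbelianVarietyRealised_holds F f.corner)
      (cornerAct cmAbelianVarietyRealised_holds F f.corner) a₀)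
    (biproduct.π (cornerAV cmAbelianVarietyRealised_holds F f.corner))
    (biproduct_π_comp_cornerAct cmAbelianVarietyRealised_holds F f.corner a₀)
    (nonempty_isLimit_fan_cornerAV cmAbelianVarietyRealised_holds F f.corner) hdim hsp
    (eval₂_diagHom_minpoly F _ _ a₀) ?_ w hwQ ?_ hw
  · -- no real root
    intro ρ hρ him
    exact hreal ρ hρ (Complex.conj_eq_iff_im.mpr him)
  · -- complex conjugation is a rational polynomial on the roots
    obtain ⟨Q, hQ⟩ := hQ
    exact ⟨Q, fun ρ hρ => by rw [Polynomial.aeval_def]; exact hQ ρ hρ⟩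
  · -- of Weil type `(2,2)`
    intro c hc
    rw [← hdim]
    exact isOfHodgeType_two_two_of_mem_weilClassesField_corner cmAbelianVarietyRealised_holds F f a₀ hsep
      (minpoly ℤ a₀) hc
  · -- Hodge type `(2,2)` read at dimension `4g`
    rw [← hdim]
    exact hwH

end Summit.HodgeConjecture.CorCM.RankFourWeil

end
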